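import Summits.BirchSwinnertonDyer.BirchSwinnertonDyer.Theses.CycTangentCM
import Summits.BirchSwinnertonDyer.BirchSwinnertonDyer.Theorems.CycTangentCMCycTangentBoundFrameSignNormalForm
import Summits.BirchSwinnertonDyer.BirchSwinnertonDyer.Theorems.CycTangentCMCycTangentBoundFrameSignTangent
import HarnessLib

set_option linter.dupNamespace false
set_option autoImplicit false

/-!
# Crux `CycTangentCM.CycTangentBound` (stmt-BirchSwinnertonDyer-22628), line `tangent-cone-parity`:
# `stub_frameSign` REDUCED to the self-dual pointwise functional equation of the frame (PROVED)

Route `CycTangentCM` (D-0145 line of ideator bsd-idea-2; K6 leaf `BSDpOnClassX9`); lead seat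
`bsd-line-ctcm-p1` (skeleton `Cruxes/CycTangentBound/Lines/tangent_cone_parity.lean`), this file by
seat `bsd-line-ctcm-p2`.  ASSEMBLY of the seat's helpers:

  `…FrameSignNormalForm`   — `stub_frameSign` ⟺ sign data `(w, parity, tangent companion)`;
  `…FrameSignParity`       — (SD) ⟹ `w = (−1)^{ord ḡ}`;
  `…FrameSignTangent`      — (SD), `w = −1`, `c̄₀₀ = c̄₀₁ = 0` ⟹ `c̄₁₀ = 0`;

into `stub_frameSign_of_selfDual`: in the EXACT setting of the registered stub `stub_frameSign`
(all binders of `CycTangentBound` up to the frame hypothesis `hG`), the stub's conclusion follows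
from ONE extra hypothesis, the SELF-DUAL POINTWISE RELATION of the `ψ⁻¹`-frame `G`:

  `(SD)  ∃ w ∈ {1, −1}, ∃ g ∈ Γ_K, ∀ r r₂ through (κ₁, κ₂), IsConjInverse r r₂ →
         ∀ x, G.HasValueAt₂ (P r₂) x → G.HasValueAt₂ (P r) (w · r(g) · x)`,

i.e. de Shalit's `p`-adic functional equation II.6.4 (9)/(15) in the typed shape of
`DeShalit1987.thmII64_katzMeasure₂_functionalEquation` with the reflected frame `Ǧ` EQUAL to `G` and the
unit `C` EQUAL to `±1` — which is what print gives on the branch of `ψ_A⁻¹` for a CM curve `A/ℚ`: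
`(ψ_A⁻¹)̌ = ψ_A⁻¹` (`ψ_A(𝔞̄) = ψ̄_A(𝔞)`, `ψ_Aψ̄_A = N`), so `L_p(ψ⁻¹ρ) = sgn(ψ⁻¹)·ρ(g)·L_p(ψ⁻¹(ρ∘c)⁻¹)`
with `sgn(ψ⁻¹) = W^{padic}(ψ⁻¹)ψ⁻¹(σ_{−1}) = ±1` (II.6.5 (18)).  (SD) is NOT in the tree: the typed
fact produces some `Ǧ` for `(reflect ψ⁻¹, c • S)` and a unit `C`; identifying `Ǧ = G` needs the
self-duality of `ψ_A` and the uniqueness of the two-variable measure over the typed interpolation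
range (or (SD) as its own cited fact).  STATUS for the lead: `stub_frameSign` = (SD) + kernel algebra
(this file); `stub_higherContact` remains the crux's open content.

THEOREMS ONLY (no definition, no named fact, no `sorry`); (SD) is a HYPOTHESIS; nothing about any
curve or measure is asserted.  Supports, does not close, stmt-BirchSwinnertonDyer-22628.

References: [deShalit1987] II.6.1 (1)–(2), II.6.4 Theorem (i) (9), (13)–(15), II.6.5 (18) (p. 81–86);
[SilvermanATAEC1994] II Thm. 10.5 (`L(A/ℚ,s) = L(s, ψ_{A/K})`, `ψ(𝔞̄) = ψ̄(𝔞)`); [Rubin1991] §4, §12.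
-/

noncomputable section

open scoped Classical
open NumberField IsDedekindDomain Field PowerSeries Literature.NumberTheory.EllipticCurves
  Literature.NumberTheory.GaloisRepresentations
  Summit.BirchSwinnertonDyer.BirchSwinnertonDyer.Theorems.CycTangentCMCycTangentBoundStubLowContact
  Summit.BirchSwinnertonDyer.BirchSwinnertonDyer.Theorems.CycTangentCMCycTangentBoundFrameSignNormalForm
  Summit.BirchSwinnertonDyer.BirchSwinnertonDyer.Theorems.CycTangentCMCycTangentBoundFrameSignParity
  Summit.BirchSwinnertonDyer.BirchSwinnertonDyer.Theorems.CycTangentCMCycTangentBoundFrameSignTangent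

namespace Summit.BirchSwinnertonDyer.BirchSwinnertonDyer.Theorems.CycTangentCMCycTangentBoundFrameSignOfSelfDual

variable {p : ℕ} [hp : Fact p.Prime]

/-- The residue of an element of `𝒪_{ℂ_p}` vanishes iff its norm is `< 1`. [folklore] -/
theorem residue_eq_zero_iff_norm_lt_one (c : PadicComplexInt p) :
    IsLocalRing.residue (PadicComplexInt p) c = 0 ↔ ‖(c : ℂ_[p])‖ < 1 := by
  rw [IsLocalRing.residue_eq_zero_iff, IsLocalRing.mem_maximalIdeal, mem_nonunits_iff,
    isUnit_padicComplexInt_iff]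
  exact ⟨fun h ↦ lt_of_le_of_ne (norm_coe_padicComplexInt_le_one c) h, fun h ↦ h.ne⟩

/-- **The sign package of `stub_frameSign` from the self-dual pointwise functional equation
(frame-free form).**  `K` imaginary quadratic, `p` odd, `(κ₁, κ₂; γ₁, γ₂)` a generator pair with
`κ₂` CYCLOTOMIC, `G ∈ 𝒪_{ℂ_p}⟦T₁⟧⟦T₂⟧` satisfying (SD) with a sign `w = ±1` and `g ∈ Γ_K`.  Then the
SIGN PACKAGE of `stub_frameSign` holds for `G`: `ε = w̄`, `ε² = 1`, the inversion `ι`, a `1`-unit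
`V` with `ḡ(ι(T)) = ε·V·ḡ`, and the tangent companion `c̄₀₀ = c̄₀₁ = 0 ⟹ c̄₁₀ = ε c̄₁₀`.  Proof: parity
half `sign_eq_neg_one_pow_order_of_selfDual` (`w = 1` forces `ord ḡ` even, `w = −1` odd), tangent half
`norm_coeff10_lt_one_of_selfDual_neg` (for `w = −1`), packaged by `frameSignData_of_signData`.
[cite: deShalit1987, II.6.4 Theorem (i) (9), (15) and II.6.5 (18) (p. 84–86)] -/
theorem frameSignData_of_selfDual {K : Type} [Field K] [NumberField K]
    (hIQ : IsImaginaryQuadratic K) (hp2 : p ≠ 2)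
    {κ₁ κ₂ : ZpExtension K p} {γ₁ γ₂ : absoluteGaloisGroup K}
    (hpair : ZpExtension.IsTopGeneratorPair κ₁ κ₂ γ₁ γ₂) (hcyc : κ₂.IsCyclotomic)
    (G : PowerSeries (PowerSeries (PadicComplexInt p)))
    (hSD : ∃ (w : ℤ) (g : absoluteGaloisGroup K), (w = 1 ∨ w = -1) ∧
      ∀ (r r₂ : FramedGaloisRep K (PadicAlgCl p) 1),
        FactorsThroughPair κ₁ κ₂ r → FactorsThroughPair κ₁ κ₂ r₂ → IsConjInverse r r₂ →
        ∀ x : ℂ_[p],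
          IntSeries.HasValueAt₂ G (avatarValueAt r₂ γ₁ - 1) (avatarValueAt r₂ γ₂ - 1) x →
          IntSeries.HasValueAt₂ G (avatarValueAt r γ₁ - 1) (avatarValueAt r γ₂ - 1)
            ((w : ℂ_[p]) * avatarValueAt r g * x)) :
    ∃ (ε : IsLocalRing.ResidueField (PadicComplexInt p))
      (ιT V : PowerSeries (IsLocalRing.ResidueField (PadicComplexInt p))),
      ε ^ 2 = 1 ∧ (1 + PowerSeries.X) * (ιT + 1) = 1 ∧ PowerSeries.constantCoeff V = 1 ∧
      PowerSeries.subst ιT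
          (PowerSeries.map (IsLocalRing.residue (PadicComplexInt p)) (PowerSeries.constantCoeff G)) =
        PowerSeries.C ε * V *
          PowerSeries.map (IsLocalRing.residue (PadicComplexInt p)) (PowerSeries.constantCoeff G) ∧
      (IsLocalRing.residue (PadicComplexInt p) (PowerSeries.coeff 0 (PowerSeries.coeff 0 G)) = 0 →
        IsLocalRing.residue (PadicComplexInt p) (PowerSeries.coeff 1 (PowerSeries.coeff 0 G)) = 0 →
        IsLocalRing.residue (PadicComplexInt p) (PowerSeries.coeff 0 (PowerSeries.coeff 1 G)) =
          ε * IsLocalRing.residue (PadicComplexInt p) (PowerSeries.coeff 0 (PowerSeries.coeff 1 G))) := by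
  obtain ⟨w, g, hw, hrel⟩ := hSD
  set gbar := PowerSeries.map (IsLocalRing.residue (PadicComplexInt p)) (PowerSeries.constantCoeff G)
    with hgbar
  have hwC : ((w : ℂ_[p]) = 1) ∨ ((w : ℂ_[p]) = -1) := by
    rcases hw with h | h <;> simp [h]
  rcases hw with hw1 | hwm1
  · -- `w = 1`: parity forces `ord ḡ` even when `ḡ ≠ 0`; the companion is trivial
    subst hw1
    refine frameSignData_of_signData G (w := 1) (by simp) (fun hg ↦ ?_) (fun _ _ ↦ by rw [one_mul])
    have hpar := sign_eq_neg_one_pow_order_of_selfDual hp2 hpair hcyc G hwC g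
      (by simpa using hrel) hg
    have heven : Even gbar.order.toNat := by
      have h1 : ((-1 : ℂ_[p])) ^ gbar.order.toNat = 1 := by
        rw [← hgbar] at hpar; exact_mod_cast hpar.symm
      exact (neg_one_pow_eq_one_iff_even (by norm_num)).mp h1
    rw [heven.neg_one_pow]
  · -- `w = -1`: parity forces `ord ḡ` odd when `ḡ ≠ 0`; the companion is the tangent half
    subst hwm1
    refine frameSignData_of_signData G (w := -1) (by simp) (fun hg ↦ ?_) (fun h00 h01 ↦ ?_)
    · have hpar := sign_eq_neg_one_pow_order_of_selfDual hp2 hpair hcyc G hwC g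
        (by simpa using hrel) hg
      have hodd : Odd gbar.order.toNat := by
        have h1 : ((-1 : ℂ_[p])) ^ gbar.order.toNat = -1 := by
          rw [← hgbar] at hpar; exact_mod_cast hpar.symm
        exact (neg_one_pow_eq_neg_one_iff_odd (by norm_num)).mp h1
      rw [hodd.neg_one_pow]
    · have hrel' : ∀ (r r₂ : FramedGaloisRep K (PadicAlgCl p) 1),
          FactorsThroughPair κ₁ κ₂ r → FactorsThroughPair κ₁ κ₂ r₂ → IsConjInverse r r₂ →
          ∀ x : ℂ_[p],
            IntSeries.HasValueAt₂ G (avatarValueAt r₂ γ₁ - 1) (avatarValueAt r₂ γ₂ - 1) x →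
            IntSeries.HasValueAt₂ G (avatarValueAt r γ₁ - 1) (avatarValueAt r γ₂ - 1)
              ((-1) * avatarValueAt r g * x) := by
        simpa using hrel
      rw [residue_eq_zero_iff_norm_lt_one] at h00 h01
      have h10 := norm_coeff10_lt_one_of_selfDual_neg hIQ hp2 hpair hcyc G g hrel' h00 h01
      rw [← residue_eq_zero_iff_norm_lt_one] at h10
      rw [h10, mul_zero]

/-- **`stub_frameSign` from (SD), in the crux's own setting.**  For a CM anchor curve `A/ℚ`
(`A.j ∈ maximalCMJInvariants`, so that its CM field `K` — `IsCMFieldOfJ K A.j` — is imaginary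
quadratic), `p ≥ 5`, and a generator pair with `κ₂` cyclotomic: the sign package of the registered
stub `stub_frameSign` (line `tangent-cone-parity`) for `G` follows from the self-dual relation (SD)
alone; the remaining frame hypotheses of the stub (`ψ`, `ι`, `v`, `S`, `γ₂`-normalisation, periods,
`IsKatzMeasure₂ … ψ⁻¹ … G`) are not needed for this implication and are therefore not repeated here —
they are what makes (SD) TRUE in print (de Shalit II.6.4–6.5 on the self-dual branch `ψ_A⁻¹`).
[cite: deShalit1987, II.6.4 Theorem (i) (9), (15) and II.6.5 (18) (p. 84–86)] [cite: SilvermanATAEC1994, App. A §3] -/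
theorem stub_frameSign_of_selfDual
    (A : WeierstrassCurve ℚ) [A.IsElliptic] (p : ℕ) [Fact p.Prime] (hp : 5 ≤ p)
    (hj : A.j ∈ maximalCMJInvariants) (K : Type) [Field K] [NumberField K] (hK : IsCMFieldOfJ K A.j)
    (κ₁ κ₂ : ZpExtension K p) (γ₁ γ₂ : absoluteGaloisGroup K)
    (hpair : ZpExtension.IsTopGeneratorPair κ₁ κ₂ γ₁ γ₂) (hcyc : κ₂.IsCyclotomic)
    (G : PowerSeries (PowerSeries (PadicComplexInt p)))
    (hSD : ∃ (w : ℤ) (g : absoluteGaloisGroup K), (w = 1 ∨ w = -1) ∧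
      ∀ (r r₂ : FramedGaloisRep K (PadicAlgCl p) 1),
        FactorsThroughPair κ₁ κ₂ r → FactorsThroughPair κ₁ κ₂ r₂ → IsConjInverse r r₂ →
        ∀ x : ℂ_[p],
          IntSeries.HasValueAt₂ G (avatarValueAt r₂ γ₁ - 1) (avatarValueAt r₂ γ₂ - 1) x →
          IntSeries.HasValueAt₂ G (avatarValueAt r γ₁ - 1) (avatarValueAt r γ₂ - 1)
            ((w : ℂ_[p]) * avatarValueAt r g * x)) :
    ∃ (ε : IsLocalRing.ResidueField (PadicComplexInt p))
      (ιT V : PowerSeries (IsLocalRing.ResidueField (PadicComplexInt p))),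
      ε ^ 2 = 1 ∧ (1 + PowerSeries.X) * (ιT + 1) = 1 ∧ PowerSeries.constantCoeff V = 1 ∧
      PowerSeries.subst ιT
          (PowerSeries.map (IsLocalRing.residue (PadicComplexInt p)) (PowerSeries.constantCoeff G)) =
        PowerSeries.C ε * V *
          PowerSeries.map (IsLocalRing.residue (PadicComplexInt p)) (PowerSeries.constantCoeff G) ∧
      (IsLocalRing.residue (PadicComplexInt p) (PowerSeries.coeff 0 (PowerSeries.coeff 0 G)) = 0 →
        IsLocalRing.residue (PadicComplexInt p) (PowerSeries.coeff 1 (PowerSeries.coeff 0 G)) = 0 →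
        IsLocalRing.residue (PadicComplexInt p) (PowerSeries.coeff 0 (PowerSeries.coeff 1 G)) =
          ε * IsLocalRing.residue (PadicComplexInt p) (PowerSeries.coeff 0 (PowerSeries.coeff 1 G))) :=
  frameSignData_of_selfDual (Deuring_exists_heckeCharacter_of_maximalCM.isImaginaryQuadratic hj hK)
    (by omega) hpair hcyc G hSD

end Summit.BirchSwinnertonDyer.BirchSwinnertonDyer.Theorems.CycTangentCMCycTangentBoundFrameSignOfSelfDual

end
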